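import Summits.AtomisticToContinuum.Crystallization.Theorems.PalmUnimodularRigidityLayeredLawsSelectHcpCertificateDefsB
import Summits.AtomisticToContinuum.Crystallization.Theorems.PalmUnimodularRigidityLayeredLawsSelectHcpLocalCongruenceFrames

/-!
# Route `PalmUnimodularRigidity`, crux `LayeredLawsSelectHcp` (stmt-AtomisticToContinuum-9226):
# certificate vocabulary, part D — graph balls of labels and ball-admissible corrector data (lead c3)

Addendum to `…CertificateDefs(B).lean` (line `mtp-prestress-split-ergodic-frame`, lead c3, R3′).  The far-field law part of the
certificate transports local functionals along label PATHS; a path transport is one re-rooting at a label of graph norm `≤ n`, so the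
zero-mean theorem for directed orbit-sum correctors is needed for data whose shift lies in, and whose functional reads only, the GRAPH
BALL of radius `n` of the contact graph of the ideal hcp around the root (the near ball of part B is the radius-`2` instance).  This
reviewed module fixes that vocabulary:

* `ballLabels n` — the graph ball of radius `n`: `ballLabels 0 = {0}`, and `ballLabels (n + 1)` adjoins to every label `u` of
  `ballLabels n` its twelve labelled neighbours `nbr u ε`, `ε ∈ hcpStarIdx` (`…LocalCongruenceFrames`: in the ideal stacking touching IS
  being a labelled neighbour, `dist_ideal_eq_one_iff_nbr`);
* `CorrDatum.BallAdmissible n d` — the shift of the datum is a label of `ballLabels n` and its functional reads the labelled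
  configuration only on `ballLabels n`, through a measurable bounded function (cf. `CorrDatum.NearAdmissible`);
* `IsLocalChartOn B S z` — a local chart on the label set `B` of a point set `S`: root at the origin, `B`-values in `S`, injective on
  `B`, ideal unit struts ↔ bonds of `S` (`0 < dist ≤ 28/25`) on `B × B` (cf. `IsLocalChart` = the case `B = nearBall`);
* the elementary read-backs `zero_mem_ballLabels` (the anchor, a registered sub-goal of stmt-AtomisticToContinuum-9226),
  `ballLabels_mono`, `nbr_mem_ballLabels_succ`.

All definitions carry parameters (route-internal bookkeeping, not literature facts); everything is `[folklore]`; nothing here closes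
an item.
-/

noncomputable section

namespace Summit.AtomisticToContinuum.Crystallization.Theorems.PalmUnimodularRigidity.LayeredLawsSelectHcp

open MeasureTheory Set
open Literature.MathematicalPhysics.StatisticalMechanics Literature.Geometry.DiscreteGeometry

/-! ## Graph balls of labels -/

/-- **The graph ball of radius `n`** of the contact graph of the ideal hcp around the root, as a finite set of labels: the root for
`n = 0`, and `ballLabels (n + 1)` adjoins to every label `u ∈ ballLabels n` its twelve labelled neighbours `nbr u ε`, `ε ∈ hcpStarIdx`.
[folklore] -/
def ballLabels : ℕ → Finset (ℤ × ℤ × ℤ)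
  | 0 => {0}
  | n + 1 => (ballLabels n).biUnion fun u => insert u (hcpStarIdx.image (nbr u))

/-- **Ball-admissible corrector datum** (radius `n`): the shift is a label of the graph ball `ballLabels n` and the functional reads
the labelled configuration only on `ballLabels n`, through a measurable bounded function. [folklore] -/
def CorrDatum.BallAdmissible (n : ℕ) (d : CorrDatum) : Prop :=
  d.shift ∈ ballLabels n ∧
    ∃ (ψ : (↥(ballLabels n) → EuclideanSpace ℝ (Fin 3)) → ℝ) (C : ℝ),
      Measurable ψ ∧ (∀ X, d.φ X = ψ (fun u => X u)) ∧ ∀ X, |d.φ X| ≤ C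

/-- **Local chart on a label set `B`** of a point set `S`: root at the origin, `B`-values in `S`, injective on `B`, and ideal unit
struts ↔ bonds of `S` on `B × B`. [folklore] -/
def IsLocalChartOn (B : Finset (ℤ × ℤ × ℤ)) (S : Set (EuclideanSpace ℝ (Fin 3)))
    (z : ℤ × ℤ × ℤ → EuclideanSpace ℝ (Fin 3)) : Prop :=
  z 0 = 0 ∧ (∀ u ∈ B, z u ∈ S) ∧ Set.InjOn z ↑B ∧
    ∀ u ∈ B, ∀ w ∈ B,
      dist (hcpSite 1 (Real.sqrt (2 / 3)) u) (hcpSite 1 (Real.sqrt (2 / 3)) w) = 1 ↔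
        (0 < dist (z u) (z w) ∧ dist (z u) (z w) ≤ 28 / 25)

/-! ## Elementary read-backs -/

/-- Anchor (registered sub-goal of stmt-AtomisticToContinuum-9226): the root is a label of every graph ball. [folklore] -/
theorem zero_mem_ballLabels : ∀ n : ℕ, (0 : ℤ × ℤ × ℤ) ∈ ballLabels n := by
  intro n
  induction n with
  | zero => exact Finset.mem_singleton_self _
  | succ n ih => exact Finset.mem_biUnion.2 ⟨0, ih, Finset.mem_insert_self _ _⟩

/-- The graph balls increase with the radius. [folklore] -/
theorem ballLabels_mono : ∀ n : ℕ, ballLabels n ⊆ ballLabels (n + 1) :=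
  fun _ u hu => Finset.mem_biUnion.2 ⟨u, hu, Finset.mem_insert_self _ _⟩

/-- The labelled neighbours of a label of the ball of radius `n` are labels of the ball of radius `n + 1`. [folklore] -/
theorem nbr_mem_ballLabels_succ : ∀ (n : ℕ), ∀ u ∈ ballLabels n, ∀ ε ∈ hcpStarIdx, nbr u ε ∈ ballLabels (n + 1) :=
  fun _ u hu ε hε =>
    Finset.mem_biUnion.2 ⟨u, hu, Finset.mem_insert_of_mem (Finset.mem_image.2 ⟨ε, hε, rfl⟩)⟩

end Summit.AtomisticToContinuum.Crystallization.Theorems.PalmUnimodularRigidity.LayeredLawsSelectHcp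

end
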